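import Summits.Langlands.Langlands.Theses.PrimeTwistSeparationLadder

/-!
# Route PrimeTwistSeparationLadder — Assembly

The assembly item (stmt-Langlands-28520) of the child route `PrimeTwistSeparationLadder` (decomp-langlands lens-1 gen 17; refines the declared
residual C′° = `ImprimitiveDescentLadder.PrimitiveCriticalDescent`, stmt-Langlands-28143) for the Langlands summit:
`CriticalPrimeDegreeDescent → CompositeDegreeDescent → PrimitiveCriticalFrame → Langlands`.

This is literally the type of the route file's sorry-free deciding theorem `Summit.Langlands.Langlands.Theses.PrimeTwistSeparationLadder.closes`
(FRAME‴ reduces `Langlands` to C′°; `by_cases` on primality of the degree `d = [K:K₀]` dispatches to X_P or X_C).  Nothing here proves `Langlands`: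
the assembly records only that the three ledger items of the route, taken together, imply the summit statement.
-/

set_option linter.dupNamespace false -- project-wide option (lakefile weak.linter.dupNamespace); `Summit.Langlands.Langlands` is the mandated namespace

namespace Summit.Langlands.Langlands.Theorems

/-- **Assembly of route PrimeTwistSeparationLadder** (stmt-Langlands-28520): `X_P → X_C → FRAME‴ → Langlands`.  Proof: unfold `Assembly` and apply
the route's deciding theorem `Theses.PrimeTwistSeparationLadder.closes`. -/
theorem primeTwistSeparationLadder_assembly_proof :
    Summit.Langlands.Langlands.Theses.PrimeTwistSeparationLadder.Assembly := by
  unfold Summit.Langlands.Langlands.Theses.PrimeTwistSeparationLadder.Assembly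
  exact Summit.Langlands.Langlands.Theses.PrimeTwistSeparationLadder.closes

end Summit.Langlands.Langlands.Theorems
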